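import Summits.Ventures.Crystal3D.Theorems.StickyWulffConstantTextureLiminfTexShadowLevelReachBornBarlowTop
import Summits.Ventures.Crystal3D.Theorems.StickyWulffConstantTextureLiminfTexShadowLevelReachHexagonBarlowShapeTop
import Summits.Ventures.Crystal3D.Theorems.StickyWulffConstantCoaxialWallLawEndRowRootDischarge
import Summits.Ventures.Crystal3D.Theorems.StickyWulffConstantCoaxialWallLawEndRowJointDefs
import HarnessLib

/-!
# FOUR families under ONE bi-frame row: both plates' cut hexagon censuses AND the two plate-adjacent BORN families, pooled
# (lane T, crux `TextureLiminfV5`, stmt-Ventures-23912, registered stub `stub_terraceCensus`; (β) assembly RESUME (d) — cf-p1 (cccxii): «four-family pooling under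
# ONE `LocalEndRowA v2 (9/2) (basalSystem Fr) (basalSystem G₂)` is the assembly shape of record»)

HONEST FRAMING. Venture `Summits/Ventures/Crystal3D` (cell `crystal3d-full`), route `route-Ventures-StickyWulffConstant`, helper `--supports` the law-v5
crux `TextureLiminfV5` (stmt-Ventures-23912), lane T, mechanism (β).  Census-free and certificate-free: the payer-side input is lane F's ABSTRACT row
`LocalEndRowA ver sF (basalSystem Fr) (basalSystem G₂)` BY NAME (any `sF`; the registrable texts (α) `BiFrameGradedCapWin₃ (9/2)` + `ThreePayer` ⇒ it by
p749434, (β′) the root row by p749973); `KissingGap δ` / `KissingClassification δ` by name.  Nothing about energies; F-C1 not moved.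

THE POINT.  The four typed end-pair families of the (β) global-pooling census — bottom plate rising hexagon lines (`hexagon_barlow_endPairs_cuts_shape`,
p747189), top plate falling hexagon lines (`hexagon_barlow_endPairs_cuts_shape_top`), a RISING born family launched in a lamella frame `A₁` along `A₁ w₁`
(`born_barlow_endPairs`) and a FALLING born family in a frame `A₂` along `A₂ w₂` (`born_barlow_endPairs_top`) — are pairwise DISJOINT (rising vs falling by
the sign of `(bq.1 − bq.2)₂`; plate vs born on the same side by direction: `A₁ w₁` is no basal direction of `Fr`, `A₂ w₂` none of `G₂` — hypotheses `hdir₁`,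
`hdir₂`), every pair is an `IsEndPairA` of the PAIR of full plate systems `(basalSystem Fr, basalSystem G₂)` (plates: `inPlaneRoots ⊆ basalHexagon` and
`PlateSystem.adm_mono`; born: the PRESENTATION hypotheses `hadm₁`, `hadm₂` — discharged for the plate-adjacent lamellae by `PlateSystem.adm_fw_singleton_of_crossed`
(p750661) — and `isEndPairA_of_rootMove` (p749779)), so ONE application of `card_endPairs_le_of_localRowA` (p749075) gives
**`fourFamily_sources_le_payers_cuts`**:
`Σ src₁ + Σ src₂ + #B₁win + #B₂win ≤ sF·Σ_PAYW(12 − deg) + Σ CUT₁ + Σ CUT₂ + CUT₃ + CUT₄ + #RT₁·rims + #RT₂·rims′ + rims + rims′` (in `ℝ`), every term verbatim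
from the four component theorems (one widened payer window `[−(R₀+1)−2, h+(R₀+1)+2]`).  Numerics of record (PRESENTABLE-SUPPLY-g24): with the born supply of
the two plate-adjacent lamellae this count carries margin ≥ 1.16 on the EdgeOn class, 1.55 on the sliver (envelope model), against plates-only 0.83–1.04.
WHAT THIS IS NOT: the row (a hypothesis), born SUPPLY (a lower bound on `#B_i win` — the riser law), the flux/area conversion, any certificate; F-C1 not moved.
-/

noncomputable section

namespace Summit.Ventures.Crystal3D.Theorems

open Summit.Ventures.Crystal3D Finset
open Literature.MathematicalPhysics.StatisticalMechanics (barlowPos barlowStacking IsHaggSeq barlowPos_mem basalMirror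
  basalMirror_apply_coord basalMirror_basalMirror)
open Summit.Ventures.Crystal3D.Cruxes.TextureLiminf.TexShadow (E3 stacking)
open scoped InnerProductSpace

set_option maxHeartbeats 800000 in
open scoped Classical in
/-- **Four families under ONE bi-frame row.**  See the module docstring.  Cell data as in `hexagon_twoPlate_sources_le_payers_cuts`; born data
`(A₁, w₁, B₁)` rising with `A₁`-dozen not a top-plate dozen, `(A₂, w₂, B₂)` falling with `A₂`-dozen not a bottom-plate dozen; presentation `hadm₁`, `hadm₂`;
direction separation `hdir₁`, `hdir₂`; the row for `(basalSystem Fr, basalSystem G₂)`. -/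
theorem fourFamily_sources_le_payers_cuts (ver : WordVersion) {δ : ℝ} (hg : KissingGap δ) (hc : KissingClassification δ)
    {σ₁ σ₂ : ℤ → ℤ} (hσ₁ : IsHaggSeq σ₁) (hσ₂ : IsHaggSeq σ₂) (L₁ L₂ : E3 ≃ₗᵢ[ℝ] E3) (s₁ s₂ : E3)
    (Fr : E3 ≃ₗᵢ[ℝ] E3) {t : ℤ} (hFr : (t = 1 ∧ Fr = L₁) ∨ (t = -1 ∧ Fr = basalMirror.trans L₁))
    (G₂ : E3 ≃ₗᵢ[ℝ] E3) {t' : ℤ} (hG₂ : (t' = 1 ∧ G₂ = L₂) ∨ (t' = -1 ∧ G₂ = basalMirror.trans L₂))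
    (hne₁ : (Fr : E3 → E3) '' ↑fccSlots ≠ (L₂ : E3 → E3) '' ↑fccSlots)
    (hne₂ : (Fr : E3 → E3) '' ↑fccSlots ≠ ((basalMirror.trans L₂ : E3 ≃ₗᵢ[ℝ] E3) : E3 → E3) '' ↑fccSlots)
    (hne₁' : (G₂ : E3 → E3) '' ↑fccSlots ≠ (L₁ : E3 → E3) '' ↑fccSlots)
    (hne₂' : (G₂ : E3 → E3) '' ↑fccSlots ≠ ((basalMirror.trans L₁ : E3 ≃ₗᵢ[ℝ] E3) : E3 → E3) '' ↑fccSlots)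
    -- the rising born family (a lamella frame above the bottom plate)
    (A₁ : E3 ≃ₗᵢ[ℝ] E3)
    (hneA₁ : (A₁ : E3 → E3) '' ↑fccSlots ≠ (L₂ : E3 → E3) '' ↑fccSlots)
    (hneA₁' : (A₁ : E3 → E3) '' ↑fccSlots ≠ ((basalMirror.trans L₂ : E3 ≃ₗᵢ[ℝ] E3) : E3 → E3) '' ↑fccSlots)
    {w₁ : E3} (hw₁ : w₁ ∈ fccSlots) (hup₁ : 0 < (A₁ w₁) 2)
    (hadm₁ : (basalSystem Fr).Adm A₁ (A₁ w₁) ∨ (basalSystem G₂).Adm A₁ (A₁ w₁))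
    (hdir₁ : ∀ r ∈ basalHexagon, A₁ w₁ ≠ Fr r)
    -- the falling born family (a lamella frame below the top plate)
    (A₂ : E3 ≃ₗᵢ[ℝ] E3)
    (hneA₂ : (A₂ : E3 → E3) '' ↑fccSlots ≠ (L₁ : E3 → E3) '' ↑fccSlots)
    (hneA₂' : (A₂ : E3 → E3) '' ↑fccSlots ≠ ((basalMirror.trans L₁ : E3 ≃ₗᵢ[ℝ] E3) : E3 → E3) '' ↑fccSlots)
    {w₂ : E3} (hw₂ : w₂ ∈ fccSlots) (hdown₂ : (A₂ w₂) 2 < 0)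
    (hadm₂ : (basalSystem Fr).Adm A₂ (A₂ w₂) ∨ (basalSystem G₂).Adm A₂ (A₂ w₂))
    (hdir₂ : ∀ r ∈ basalHexagon, A₂ w₂ ≠ G₂ r)
    {sF : ℝ} (hrow : LocalEndRowA ver sF (basalSystem Fr) (basalSystem G₂))
    (X P₁ P₂ : Finset E3) (R₀ h ρ : ℝ) (hR₀ : 5 ≤ R₀) (hρ : R₀ + 2 ≤ ρ)
    (hX : ∀ p ∈ X, ∀ q ∈ X, p ≠ q → 1 ≤ dist p q) (hP₁X : P₁ ⊆ X) (hP₂X : P₂ ⊆ X)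
    (hP₁ : ∀ p, p ∈ P₁ ↔ (p ∈ stacking L₁ s₁ σ₁ ∧ -(2 * R₀) ≤ p 2 ∧ p 2 ≤ -R₀ ∧ p 0 ^ 2 + p 1 ^ 2 ≤ ρ ^ 2))
    (hP₂ : ∀ p, p ∈ P₂ ↔ (p ∈ stacking L₂ s₂ σ₂ ∧ h + R₀ ≤ p 2 ∧ p 2 ≤ h + 2 * R₀ ∧ p 0 ^ 2 + p 1 ^ 2 ≤ ρ ^ 2))
    (B₁ B₂ : Finset E3)
    (hborn₁ : ∀ p ∈ B₁, p ∈ X ∧ IsFull X A₁ p ∧ p - A₁ w₁ ∈ X ∧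
      ¬ (p - A₁ w₁ - A₁ w₁ ∈ X ∧
        (IsFull X A₁ (p - A₁ w₁) ∨ (∃ m, IsTwinReading X A₁ m (p - A₁ w₁) ∧ ⟪A₁ w₁, m⟫_ℝ = 0) ∨
          (ver = WordVersion.v2 ∧ IsNarrow X A₁ (A₁ w₁) (p - A₁ w₁)))))
    (hborn₂ : ∀ p ∈ B₂, p ∈ X ∧ IsFull X A₂ p ∧ p - A₂ w₂ ∈ X ∧
      ¬ (p - A₂ w₂ - A₂ w₂ ∈ X ∧
        (IsFull X A₂ (p - A₂ w₂) ∨ (∃ m, IsTwinReading X A₂ m (p - A₂ w₂) ∧ ⟪A₂ w₂, m⟫_ℝ = 0) ∨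
          (ver = WordVersion.v2 ∧ IsNarrow X A₂ (A₂ w₂) (p - A₂ w₂))))) :
    ((∑ r ∈ inPlaneRoots Fr 1,
        ((P₁.filter fun p => -(R₀ + 1) - 1 - 1 ≤ p 2 ∧ p 2 ≤ -(R₀ + 1) - 1 ∧ p 0 ^ 2 + p 1 ^ 2 ≤ (ρ - 1 - 1) ^ 2).filter
          fun p => (∃ k i j : ℤ, p = L₁ (barlowPos 1 (Real.sqrt (2 / 3)) σ₁ k i j) + s₁ ∧ ¬ (σ₁ (k - 1) = -t ∧ σ₁ k = -t)) ∧
            -(R₀ + 1) - 1 < (p + Fr r) 2 ∧ (p + Fr r) 2 < h + (R₀ + 1) + 1).card : ℕ) : ℝ) +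
      ((∑ r ∈ inPlaneRoots G₂ (-1),
        ((P₂.filter fun p => h + (R₀ + 1) + 1 ≤ p 2 ∧ p 2 ≤ h + (R₀ + 1) + 1 + 1 ∧ p 0 ^ 2 + p 1 ^ 2 ≤ (ρ - 1 - 1) ^ 2).filter
          fun p => (∃ k i j : ℤ, p = L₂ (barlowPos 1 (Real.sqrt (2 / 3)) σ₂ k i j) + s₂ ∧ ¬ (σ₂ (k - 1) = -t' ∧ σ₂ k = -t')) ∧
            -(R₀ + 1) - 1 < (p + G₂ r) 2 ∧ (p + G₂ r) 2 < h + (R₀ + 1) + 1).card : ℕ) : ℝ) +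
      ((B₁.filter fun p => -(R₀ + 1) - 1 < (p + A₁ w₁) 2 ∧ (p + A₁ w₁) 2 < h + (R₀ + 1) + 1).card : ℝ) +
      ((B₂.filter fun p => -(R₀ + 1) - 1 < (p + A₂ w₂) 2 ∧ (p + A₂ w₂) 2 < h + (R₀ + 1) + 1).card : ℝ) ≤
      sF * ∑ z ∈ X.filter (fun z => (X.filter fun q => dist z q = 1).card ≤ 11 ∧
          -(R₀ + 1) - 2 ≤ z 2 ∧ z 2 ≤ h + (R₀ + 1) + 2), ((12 : ℝ) - ((X.filter fun q => dist z q = 1).card : ℝ)) +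
        ((∑ r ∈ inPlaneRoots Fr 1, (X.filter fun b => -(R₀ + 1) - 1 ≤ b 2 ∧ b 2 < h + (R₀ + 1) + 1 ∧
            (∃ μ, ⟪r, μ⟫_ℝ = Real.sqrt (2 / 3) ∧ IsTwinReading X Fr (Fr μ) b) ∧ b - Fr r ∈ X).card : ℕ) : ℝ) +
        ((∑ r ∈ inPlaneRoots G₂ (-1), (X.filter fun b => -(R₀ + 1) - 1 < b 2 ∧ b 2 ≤ h + (R₀ + 1) + 1 ∧
            (∃ μ, ⟪r, μ⟫_ℝ = Real.sqrt (2 / 3) ∧ IsTwinReading X G₂ (G₂ μ) b) ∧ b - G₂ r ∈ X).card : ℕ) : ℝ) +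
        ((X.filter fun b => -(R₀ + 1) - 1 ≤ b 2 ∧ b 2 < h + (R₀ + 1) + 1 ∧
            (∃ μ, ⟪w₁, μ⟫_ℝ = Real.sqrt (2 / 3) ∧ IsTwinReading X A₁ (A₁ μ) b) ∧ b - A₁ w₁ ∈ X).card : ℝ) +
        ((X.filter fun b => -(R₀ + 1) - 1 < b 2 ∧ b 2 ≤ h + (R₀ + 1) + 1 ∧
            (∃ μ, ⟪w₂, μ⟫_ℝ = Real.sqrt (2 / 3) ∧ IsTwinReading X A₂ (A₂ μ) b) ∧ b - A₂ w₂ ∈ X).card : ℝ) +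
        (((inPlaneRoots Fr 1).card : ℝ) + 1) *
          (220 * ((X.filter fun s => h + (R₀ + 1) + 1 ≤ s 2 ∧ s 2 ≤ h + (R₀ + 1) + 1 + 1 ∧
              (ρ - 1 - 2) ^ 2 < s 0 ^ 2 + s 1 ^ 2).card : ℝ) +
            220 * ((X.filter fun s => -(R₀ + 1) - 1 - 1 ≤ s 2 ∧ s 2 < -(R₀ + 1) - 1 ∧
              (ρ - 1 - 1) ^ 2 < s 0 ^ 2 + s 1 ^ 2).card : ℝ)) +
        (((inPlaneRoots G₂ (-1)).card : ℝ) + 1) *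
          (220 * ((X.filter fun s => -(R₀ + 1) - 1 - 1 ≤ s 2 ∧ s 2 ≤ -(R₀ + 1) - 1 ∧
              (ρ - 1 - 2) ^ 2 < s 0 ^ 2 + s 1 ^ 2).card : ℝ) +
            220 * ((X.filter fun s => h + (R₀ + 1) + 1 < s 2 ∧ s 2 ≤ h + (R₀ + 1) + 1 + 1 ∧
              (ρ - 1 - 1) ^ 2 < s 0 ^ 2 + s 1 ^ 2).card : ℝ)) := by
  set S₁ : PlateSystem := basalSystem Fr with hS₁
  set S₂ : PlateSystem := basalSystem G₂ with hS₂
  -- (1) the four families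
  obtain ⟨T₁, hkey₁, hT₁pair, hT₁pay, hT₁shape, hT₁wit⟩ := hexagon_barlow_endPairs_cuts_shape ver hg hc hσ₁ hσ₂ L₁ L₂ s₁ s₂ Fr hFr
    hne₁ hne₂ X P₁ P₂ R₀ h ρ hR₀ hρ hX hP₁X hP₂X hP₁ hP₂
  obtain ⟨T₂, hkey₂, hT₂pair, hT₂pay, hT₂shape, hT₂adm⟩ := hexagon_barlow_endPairs_cuts_shape_top ver hg hc hσ₁ hσ₂ L₁ L₂ s₁ s₂ G₂ hG₂
    hne₁' hne₂' X P₁ P₂ R₀ h ρ hR₀ hρ hX hP₁X hP₂X hP₁ hP₂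
  obtain ⟨T₃, hkey₃, hT₃pair, hT₃pay, hT₃move⟩ := born_barlow_endPairs ver hg hc hσ₂ L₁ L₂ s₁ s₂ A₁ hneA₁ hneA₁' hw₁ hup₁
    X P₁ P₂ R₀ h ρ hR₀ hρ hX hP₁X hP₂X hP₁ hP₂ B₁ hborn₁
  obtain ⟨T₄, hkey₄, hT₄pair, hT₄pay, hT₄move⟩ := born_barlow_endPairs_top ver hg hc hσ₁ L₁ L₂ s₁ s₂ A₂ hneA₂ hneA₂' hw₂ hdown₂
    X P₁ P₂ R₀ h ρ hR₀ hρ hX hP₁X hP₂X hP₁ hP₂ B₂ hborn₂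
  -- (2) the vertical sign of each family's direction `bq.1 − bq.2`
  have hsgn₁ : ∀ bq ∈ T₁, 0 < (bq.1 - bq.2) 2 := by
    intro bq hbq
    obtain ⟨r', hr', hs, -⟩ := hT₁shape bq hbq
    have hup : 0 < (Fr r') 2 := by have := (mem_filter.1 hr').2.2; linarith
    have e : bq.1 - bq.2 = Fr r' := by rw [hs]; abel
    rw [e]; exact hup
  have hsgn₂ : ∀ bq ∈ T₂, (bq.1 - bq.2) 2 < 0 := by
    intro bq hbq
    obtain ⟨r', hr', hs⟩ := hT₂shape bq hbq
    have hdn : (G₂ r') 2 < 0 := by have := (mem_filter.1 hr').2.2; linarith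
    have e : bq.1 - bq.2 = G₂ r' := by rw [hs]; abel
    rw [e]; exact hdn
  have hsgn₃ : ∀ bq ∈ T₃, 0 < (bq.1 - bq.2) 2 := by
    intro bq hbq
    obtain ⟨-, hs, -⟩ := hT₃move bq hbq
    have e : bq.1 - bq.2 = A₁ w₁ := by rw [hs]; abel
    rw [e]; exact hup₁
  have hsgn₄ : ∀ bq ∈ T₄, (bq.1 - bq.2) 2 < 0 := by
    intro bq hbq
    obtain ⟨-, hs, -⟩ := hT₄move bq hbq
    have e : bq.1 - bq.2 = A₂ w₂ := by rw [hs]; abel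
    rw [e]; exact hdown₂
  have hdisj_ud : ∀ {U D : Finset (E3 × E3)}, (∀ bq ∈ U, 0 < (bq.1 - bq.2) 2) → (∀ bq ∈ D, (bq.1 - bq.2) 2 < 0) →
      Disjoint U D := by
    intro U D hU hD
    rw [Finset.disjoint_left]
    intro bq h₁ h₂
    have := hU bq h₁; have := hD bq h₂; linarith
  -- (3) plate vs born on the same side: different directions
  have hdisj₁₃ : Disjoint T₁ T₃ := by
    rw [Finset.disjoint_left]
    intro bq h₁ h₃
    obtain ⟨r', hr', hs, -⟩ := hT₁shape bq h₁
    obtain ⟨-, hs₃, -⟩ := hT₃move bq h₃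
    have e : A₁ w₁ = Fr r' := by
      have := hs.symm.trans hs₃
      -- bq.1 - Fr r' = bq.1 - A₁ w₁
      have := sub_right_injective this
      exact this.symm
    exact hdir₁ r' (inPlaneRoots_subset_basalHexagon Fr 1 hr') e
  have hdisj₂₄ : Disjoint T₂ T₄ := by
    rw [Finset.disjoint_left]
    intro bq h₂ h₄
    obtain ⟨r', hr', hs⟩ := hT₂shape bq h₂
    obtain ⟨-, hs₄, -⟩ := hT₄move bq h₄
    have e : A₂ w₂ = G₂ r' := by
      have := hs.symm.trans hs₄
      have := sub_right_injective this
      exact this.symm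
    exact hdir₂ r' (inPlaneRoots_subset_basalHexagon G₂ (-1) hr') e
  -- (4) the pooled set and its cardinality
  set T := ((T₁ ∪ T₃) ∪ (T₂ ∪ T₄)) with hT
  have hd13 : Disjoint T₁ T₃ := hdisj₁₃
  have hd24 : Disjoint T₂ T₄ := hdisj₂₄
  have hdUD : Disjoint (T₁ ∪ T₃) (T₂ ∪ T₄) := by
    rw [disjoint_union_left, disjoint_union_right, disjoint_union_right]
    exact ⟨⟨hdisj_ud hsgn₁ hsgn₂, hdisj_ud hsgn₁ hsgn₄⟩, ⟨hdisj_ud hsgn₃ hsgn₂, hdisj_ud hsgn₃ hsgn₄⟩⟩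
  have hTcard : T.card = T₁.card + T₃.card + (T₂.card + T₄.card) := by
    rw [hT, card_union_of_disjoint hdUD, card_union_of_disjoint hd13, card_union_of_disjoint hd24]
  -- (5) every pooled pair is an (A)-end pair of (basalSystem Fr, basalSystem G₂)
  have hsub₁ : inPlaneRoots Fr 1 ⊆ basalHexagon := inPlaneRoots_subset_basalHexagon Fr 1
  have hsub₂ : inPlaneRoots G₂ (-1) ⊆ basalHexagon := inPlaneRoots_subset_basalHexagon G₂ (-1)
  -- `Adm` is monotone in the root set (inline; the tree lemma `PlateSystem.adm_mono` lives in the L12Local-tainted '…RowsOfJoint')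
  have adm_mono' : ∀ {G₀ : EuclideanSpace ℝ (Fin 3) ≃ₗᵢ[ℝ] EuclideanSpace ℝ (Fin 3)} {R R' : Finset (EuclideanSpace ℝ (Fin 3))},
      R ⊆ R' → ∀ {G : EuclideanSpace ℝ (Fin 3) ≃ₗᵢ[ℝ] EuclideanSpace ℝ (Fin 3)} {d : EuclideanSpace ℝ (Fin 3)},
      (⟨G₀, R⟩ : PlateSystem).Adm G d → (⟨G₀, R'⟩ : PlateSystem).Adm G d := by
    intro G₀ R R' h G d hadm
    obtain ⟨r, hr, κ, hκ, hG, hd⟩ := hadm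
    have e : (⟨G₀, R⟩ : PlateSystem).Fw κ = (⟨G₀, R'⟩ : PlateSystem).Fw κ :=
      PlateSystem.fw_eq_of_G₀ (S := ⟨G₀, R⟩) (S' := ⟨G₀, R'⟩) rfl κ
    exact ⟨r, h hr, κ, hκ, by rw [hG, e], by rw [hd, e]⟩
  have hEP : ∀ bq ∈ T, IsEndPairA X ver S₁ S₂ bq.1 bq.2 := by
    intro bq hbq
    rcases mem_union.1 hbq with h13 | h24
    · rcases mem_union.1 h13 with h₁ | h₃
      · obtain ⟨hb, hq, -, -, -⟩ := hT₁pair bq h₁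
        obtain ⟨r, hr, κ, hWF, hpred, hmove⟩ := hT₁wit bq h₁
        have hadm : S₁.Adm ((⟨Fr, inPlaneRoots Fr 1⟩ : PlateSystem).Fw κ)
            ((⟨Fr, inPlaneRoots Fr 1⟩ : PlateSystem).Fw κ (((-1 : ℝ) ^ κ.length) • r)) :=
          adm_mono' hsub₁ ⟨r, hr, κ, hWF, rfl, rfl⟩
        exact ⟨hq, hb, hT₁pay bq h₁, _, _, Or.inl hadm, hpred, hmove⟩
      · obtain ⟨hb, hq, -, -, -⟩ := hT₃pair bq h₃
        obtain ⟨-, -, -, hpp, hmove⟩ := hT₃move bq h₃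
        exact isEndPairA_of_rootMove hadm₁ hq hb (hT₃pay bq h₃) hpp hmove
    · rcases mem_union.1 h24 with h₂ | h₄
      · obtain ⟨hb, hq, -, -, -⟩ := hT₂pair bq h₂
        obtain ⟨G', d', hadm, hpred, hmove⟩ := hT₂adm bq h₂
        exact ⟨hq, hb, hT₂pay bq h₂, G', d', Or.inr (adm_mono' hsub₂ hadm), hpred, hmove⟩
      · obtain ⟨hb, hq, -, -, -⟩ := hT₄pair bq h₄
        obtain ⟨-, -, -, hpp, hmove⟩ := hT₄move bq h₄
        exact isEndPairA_of_rootMove hadm₂ hq hb (hT₄pay bq h₄) hpp hmove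
  -- (6) ONE application of the local row
  set PAYW := X.filter (fun z => (X.filter fun q => dist z q = 1).card ≤ 11 ∧
    -(R₀ + 1) - 2 ≤ z 2 ∧ z 2 ≤ h + (R₀ + 1) + 2) with hPAYW
  have hwin : ∀ bq ∈ T, -(R₀ + 1) - 1 ≤ bq.1 2 ∧ bq.1 2 ≤ h + (R₀ + 1) + 1 := by
    intro bq hbq
    rcases mem_union.1 hbq with h13 | h24
    · rcases mem_union.1 h13 with h₁ | h₃
      · obtain ⟨-, -, -, h4, h5⟩ := hT₁pair bq h₁; exact ⟨h4, h5.le⟩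
      · obtain ⟨-, -, -, h4, h5⟩ := hT₃pair bq h₃; exact ⟨h4, h5.le⟩
    · rcases mem_union.1 h24 with h₂ | h₄
      · obtain ⟨-, -, -, h4, h5⟩ := hT₂pair bq h₂; exact ⟨h4.le, h5⟩
      · obtain ⟨-, -, -, h4, h5⟩ := hT₄pair bq h₄; exact ⟨h4.le, h5⟩
  have hclosed : ∀ bq ∈ T, ∀ z ∈ X, dist bq.1 z ≤ 1 → (X.filter fun q => dist z q = 1).card ≤ 11 → z ∈ PAYW := by
    intro bq hbq z hzX hdz hz11
    obtain ⟨h4, h5⟩ := hwin bq hbq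
    have h2 : (z 2 - bq.1 2) ^ 2 ≤ 1 := by
      have := sq_sub_apply_le_dist_sq z bq.1 2
      rw [dist_comm] at hdz; nlinarith [this, hdz, dist_nonneg (x := z) (y := bq.1)]
    have h2' : |z 2 - bq.1 2| ≤ 1 := by rw [← sq_le_one_iff_abs_le_one]; exact h2
    obtain ⟨ha, hb⟩ := abs_le.1 h2'
    exact mem_filter.2 ⟨hzX, hz11, by linarith, by linarith⟩
  have key := card_endPairs_le_of_localRowA hX ver S₁ S₂ T PAYW hEP
    (fun z hz => ⟨(mem_filter.1 hz).1, (mem_filter.1 hz).2.1⟩) hclosed hrow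
  -- (7) assemble
  rw [hTcard] at key
  push_cast at key
  have hk₁ := (Nat.cast_le (α := ℝ)).2 hkey₁
  have hk₂ := (Nat.cast_le (α := ℝ)).2 hkey₂
  have hk₃ := (Nat.cast_le (α := ℝ)).2 hkey₃
  have hk₄ := (Nat.cast_le (α := ℝ)).2 hkey₄
  push_cast at hk₁ hk₂ hk₃ hk₄ ⊢
  linarith only [hk₁, hk₂, hk₃, hk₄, key]

end Summit.Ventures.Crystal3D.Theorems

end
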